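import Literature.Analysis.FluidPDE.PassiveVectorTensorPropagatorBandKillApprox
import Literature.Analysis.FluidPDE.PassiveVectorTensorPropagatorBandKillAdjoint
import HarnessLib

/-!
# Band kill for the ADJOINT window propagator — best-approximation form of the carrier's spectral tail

Analysis/FluidPDE file (pure proof layer; no definitions, no named facts).  Same statement and proof as
`PassiveVectorTensorPropagatorBandKillAdjoint.IsPropagator.bandKill_adjoint`, with the slices of the carrier measured by their sup-norm
distance to SOME real trigonometric polynomial with frequencies in the cube `‖k‖_∞ ≤ nS − 2Δ` (negating the carrier negates the
approximant: `realTrigPoly_neg_coeff_apply`, `IsConjSymm.neg_coeff`).  `IsPropagator.bandKill_adjoint'`: for `y ∈ L²` with Fourier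
coefficients vanishing on the ladder box, (i) `Σ_{|k| ≤ L'} |𝓕((U s s′)† y)(k)|² ≤ x^{−2(J+1)} ‖y‖²`,
(ii) `‖(U s s′)† y‖² ≤ (e^{−8π² lo L'²(s′−s)} + x^{−2(J+1)}) ‖y‖²`.  Consumer: cell `ad-ideate`, K1L_D `stmt-AnomalousDissipation-27980`,
W3-E (ii) `stub_effectiveFrameEnergyL_bandKill` (F-k3l-7/8).
## Mathlib / tree search
Tree: `PassiveVectorTensorPropagatorBandKillAdjoint` (sharp version, `fourierTruncate_neg_apply`), `PassiveVectorTensorPropagatorBandKillApprox`,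
`PassiveVectorTensorPropagatorUnique.IsPropagator.adjoint_eq`, `PassiveVectorTensorPropagatorWeightedDecayAdjoint.ae_restrict_Ioo_reversed_window`.
## References
* A. Pazy, *Semigroups of Linear Operators and Applications to PDE* (1983), Ch. 1 §1.10. [`Pazy1983`]
* R. Temam, *Navier–Stokes Equations* (1984), Ch. III §1 Lemma 1.2. [`Temam1984`]
* L. Grafakos, *Classical Fourier Analysis* (3rd ed., 2014), Prop. 3.2.5. [`Grafakos2014`] -/

noncomputable section

open MeasureTheory Set Filter Complex UnitAddTorus Function Finset
open scoped ENNReal InnerProductSpace ComplexConjugate Topology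

namespace Literature.Analysis.FunctionSpaces
namespace Torus

variable {d : Type*} [Fintype d] [DecidableEq d]

omit [DecidableEq d] in
/-- Negating the coefficients negates the real trigonometric polynomial. [cite: Grafakos2014, Prop. 3.2.5] -/
theorem realTrigPoly_neg_coeff_apply (S : Finset (d → ℤ)) (c : (d → ℤ) → EuclideanSpace ℂ d) (x : UnitAddTorus d) :
    realTrigPoly S (fun k => -c k) x = -realTrigPoly S c x := by
  classical
  rw [realTrigPoly_apply_eq_sum, realTrigPoly_apply_eq_sum, ← Finset.sum_neg_distrib]
  refine Finset.sum_congr rfl fun k _ => ?_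
  rw [smul_neg, map_neg]

omit [Fintype d] [DecidableEq d] in
/-- Conjugate symmetry is preserved by negation of the coefficients. [cite: Grafakos2014, Prop. 3.2.5] -/
theorem IsConjSymm.neg_coeff {c : (d → ℤ) → EuclideanSpace ℂ d} (hc : IsConjSymm c) : IsConjSymm fun k => -c k := by
  intro k
  show -c (-k) = EuclideanSpace.conjVec (-c k)
  rw [hc k, EuclideanSpace.conjVec_neg]

end Torus
end Literature.Analysis.FunctionSpaces

namespace Literature.Analysis.FluidPDE

namespace Torus

variable {d : Type*} [Fintype d] [DecidableEq d] [Nonempty d]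
variable {T : ℝ} {𝔸 : Visc4 d} {lo hi : ℝ} {b : ℝ → UnitAddTorus d → EuclideanSpace ℝ d}
variable {U : ℝ → ℝ → (Lp (EuclideanSpace ℝ d) 2 (volume : Measure (UnitAddTorus d)) →L[ℝ]
  Lp (EuclideanSpace ℝ d) 2 (volume : Measure (UnitAddTorus d)))}

namespace IsPropagator


/-- **BAND KILL FOR THE ADJOINT WINDOW PROPAGATOR — best-approximation form of the spectral tail** (F-k3l-8).  `(U s s′)†` is the propagator of the reversed problem (carrier
`r ↦ −b(s′−r)`, tensor `majorTranspose 𝔸`, horizon `s′−s`; `IsPropagator.adjoint_eq`), whose carrier has the same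
`L^∞` bound and — slice by slice — the same continuity, Lipschitz constant and spectral tails; hence under the hypotheses of
`bandKill`, for every `y ∈ L²` whose Fourier coefficients vanish on the ladder box,
(i) `Σ_{|k| ≤ L'} |𝓕((U s s′)† y)(k)|² ≤ x^{−2(J+1)} ‖y‖²` and (ii) `‖(U s s′)† y‖² ≤ (e^{−8π² lo L'²(s′−s)} + x^{−2(J+1)}) ‖y‖²`.
[cite: Pazy1983, Ch. 1 §1.10] [cite: Temam1984, Ch. III §1 Lemma 1.2] -/
theorem bandKill_adjoint' (hU : IsPropagator T b 𝔸 U) (h𝔸 : NearIso 𝔸 lo hi) (hlo : 0 < lo)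
    (hb : MemLp (FunctionSpaces.Torus.stLift b) ∞ (volume.restrict (Ioo 0 T ×ˢ univ)))
    (hbdiv : ∀ᵐ τ ∂(volume.restrict (Ioo 0 T)), FunctionSpaces.Torus.IsWeaklyDivFree (b τ))
    (hbc : ∀ᵐ τ ∂(volume.restrict (Ioo 0 T)), Continuous (b τ))
    {Λ : ℝ} (hΛ : 0 ≤ Λ)
    (hbL : ∀ᵐ τ ∂(volume.restrict (Ioo 0 T)), ∀ x y, ‖b τ x - b τ y‖ ≤ Λ * ‖FunctionSpaces.Torus.reprc (x - y)‖)
    {K₀ S Δ J : ℕ} (hΔ : 0 < Δ) (hS : 2 * Δ ≤ S) (hJ : (J + 1) * S ≤ K₀ + S)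
    {W : ℕ → ℝ} (hW0 : ∀ n, 0 ≤ W n)
    (hW : ∀ᵐ τ ∂(volume.restrict (Ioo 0 T)), ∀ n, 1 ≤ n → n ≤ J + 1 → ∃ t : (d → ℤ) → EuclideanSpace ℂ d,
      FunctionSpaces.Torus.IsConjSymm t ∧
        ∀ x, ‖b τ x - FunctionSpaces.Torus.realTrigPoly (FunctionSpaces.Torus.cubeSupp d (n * S - 2 * Δ)) t x‖ ≤ W n)
    {s s' x : ℝ} (hs : 0 ≤ s) (hss' : s < s') (hs'T : s' ≤ T) (hx : 1 ≤ x)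
    (hladder : 4 * Real.pi * (K₀ + 2 * Δ) * (s' - s) * x *
      (2 * (Fintype.card d) ^ 2 * Λ / Δ + Fintype.card d * ∑ n ∈ Finset.range (J + 1), W (n + 1) * x ^ (n + 1)) ≤ 1)
    {L' : ℕ} (hL' : L' ≤ FunctionSpaces.Torus.rungHeight K₀ S (J + 1))
    (y : Lp (EuclideanSpace ℝ d) 2 (volume : Measure (UnitAddTorus d)))
    (hyoff : ∀ k ∈ FunctionSpaces.Torus.ladderSupp d K₀ S Δ,
      mFourierCoeff (FunctionSpaces.EuclideanSpace.complexify ∘ (y : UnitAddTorus d → EuclideanSpace ℝ d)) k = 0) :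
    (∑ k ∈ FunctionSpaces.Torus.freqBall L', ‖mFourierCoeff (FunctionSpaces.EuclideanSpace.complexify ∘
        ((ContinuousLinearMap.adjoint (U s s') y : Lp (EuclideanSpace ℝ d) 2 volume) : UnitAddTorus d → EuclideanSpace ℝ d)) k‖ ^ 2 ≤
        (x⁻¹ ^ (J + 1)) ^ 2 * ‖y‖ ^ 2) ∧
    ‖ContinuousLinearMap.adjoint (U s s') y‖ ^ 2 ≤
      (Real.exp (-(8 * Real.pi ^ 2 * lo * (L' : ℝ) ^ 2 * (s' - s))) + (x⁻¹ ^ (J + 1)) ^ 2) * ‖y‖ ^ 2 := by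
  rw [hU.adjoint_eq h𝔸 hlo hb hbdiv hs hss' hs'T]
  have h𝔸' := (nearIso_majorTranspose_iff 𝔸 lo hi).2 h𝔸
  have hb' := memLp_top_stLift_reversed_window (T := T) (b := b) hb hs hs'T
  have hbdiv' := ae_isWeaklyDivFree_reversed_window (T := T) (b := b) hbdiv hs hs'T
  have hV := isPropagator_propagator h𝔸' hlo hb' hbdiv'
  have hbc' : ∀ᵐ r ∂(volume.restrict (Ioo 0 (s' - s))), Continuous (fun x => -b (s' - r) x) := by
    filter_upwards [ae_restrict_Ioo_reversed_window (P := fun τ => Continuous (b τ)) hbc hs hs'T] with r hr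
    exact hr.neg
  have hbL' : ∀ᵐ r ∂(volume.restrict (Ioo 0 (s' - s))), ∀ x y, ‖-b (s' - r) x - -b (s' - r) y‖ ≤
      Λ * ‖FunctionSpaces.Torus.reprc (x - y)‖ := by
    filter_upwards [ae_restrict_Ioo_reversed_window
      (P := fun τ => ∀ x y, ‖b τ x - b τ y‖ ≤ Λ * ‖FunctionSpaces.Torus.reprc (x - y)‖) hbL hs hs'T] with r hr
    intro x y
    rw [show -b (s' - r) x - -b (s' - r) y = -(b (s' - r) x - b (s' - r) y) by abel, norm_neg]
    exact hr x y
  have hW' : ∀ᵐ r ∂(volume.restrict (Ioo 0 (s' - s))), ∀ n, 1 ≤ n → n ≤ J + 1 → ∃ t : (d → ℤ) → EuclideanSpace ℂ d,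
      FunctionSpaces.Torus.IsConjSymm t ∧
        ∀ x, ‖-b (s' - r) x - FunctionSpaces.Torus.realTrigPoly (FunctionSpaces.Torus.cubeSupp d (n * S - 2 * Δ)) t x‖ ≤ W n := by
    filter_upwards [ae_restrict_Ioo_reversed_window (P := fun τ => ∀ n, 1 ≤ n → n ≤ J + 1 → ∃ t : (d → ℤ) → EuclideanSpace ℂ d,
      FunctionSpaces.Torus.IsConjSymm t ∧
        ∀ x, ‖b τ x - FunctionSpaces.Torus.realTrigPoly (FunctionSpaces.Torus.cubeSupp d (n * S - 2 * Δ)) t x‖ ≤ W n) hW hs hs'T]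
      with r hr
    intro n hn hnJ
    obtain ⟨t, htc, htW⟩ := hr n hn hnJ
    refine ⟨fun k => -t k, htc.neg_coeff, fun x => ?_⟩
    rw [FunctionSpaces.Torus.realTrigPoly_neg_coeff_apply,
      show -b (s' - r) x - -FunctionSpaces.Torus.realTrigPoly (FunctionSpaces.Torus.cubeSupp d (n * S - 2 * Δ)) t x =
        -(b (s' - r) x - FunctionSpaces.Torus.realTrigPoly (FunctionSpaces.Torus.cubeSupp d (n * S - 2 * Δ)) t x) by abel, norm_neg]
    exact htW x
  have hladder' : 4 * Real.pi * (K₀ + 2 * Δ) * (s' - s - 0) * x *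
      (2 * (Fintype.card d) ^ 2 * Λ / Δ + Fintype.card d * ∑ n ∈ Finset.range (J + 1), W (n + 1) * x ^ (n + 1)) ≤ 1 := by
    rw [sub_zero]; exact hladder
  have h := hV.bandKill' h𝔸' hlo hb' hbdiv' hbc' hΛ hbL' hΔ hS hJ hW0 hW' le_rfl (sub_pos.2 hss') le_rfl hx hladder' hL' y hyoff
  rw [sub_zero] at h
  exact h

end IsPropagator

end Torus

end Literature.Analysis.FluidPDE

end
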